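import Summits.Parity.GeneralizedHardyLittlewood.Theorems.GreenTaoLevelTwoGITwoCyclicInverseLocalBilinear
import Summits.Parity.GeneralizedHardyLittlewood.Theorems.GreenTaoLevelTwoGITwoCyclicInversePhaseLipschitz
import Summits.Parity.GeneralizedHardyLittlewood.Theorems.GreenTaoLevelTwoGITwoCyclicInverseHalving
import Literature.NumberTheory.Sieve.LinearEquationsInPrimesFourierU2

/-!
# Route `GreenTaoLevelTwo`, crux `GITwo` (stmt-Parity-21275), line `birth`, stub `stub_cyclicInverse`:
# the phase-replacement step of GT08a §9 Step 3

Fifty-first helper file toward the XL stub `stub_cyclicInverse` (B. Green, T. Tao, *An inverse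
theorem for the Gowers `U³(G)` norm*, arXiv:math/0503014, Thm. 68 = PEMS 51 (2008) Thm. 12.8).
Block C13, §9 Step 3: "we observe from (madd) that `2Mh·x = M(x+h)·(x+h) − Mx·x − Mh·h − {x,h}`, and
hence by (symm-2) `|e(−2Mh·x) − b(x+h) b(h) e(Mx·x)| ≤ 2π · (bound on ‖{x,h}‖)`".  With the tree's
doubled map `μ = 2M`, `M = c·μ` (`2c = 1`, `…Halving`), the Step-3 identity `two_mul_pair_eq`
(`…LocalBilinear`) and the Lipschitz bound `norm_stdAddChar_sub_stdAddChar_le` (`…PhaseLipschitz`):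

* `norm_stdAddChar_neg_mu_sub_le` — for `μ(x+h) = μ x + μ h`:
  `‖e(−μ(h)x) − conj e(M(x+h)(x+h)) · e(M(h)h) · e(M(x)x)‖ ≤ 2π ‖M(x)h − M(h)x‖_{ℝ/ℤ}`, `M = c·μ`.

References: [GreenTao2008U3Inverse] arXiv:math/0503014, §9 Step 3.
-/

noncomputable section

namespace Summit.Parity.GeneralizedHardyLittlewood.GreenTaoLevelTwoGITwoCyclicInverse

open scoped ComplexConjugate

open Literature.NumberTheory.Sieve

variable {N : ℕ} [NeZero N]

/-- **Phase replacement (GT08a §9 Step 3).**  Let `2c = 1` in `ℤ/Nℤ`, `μ : ℤ/Nℤ → ℤ/Nℤ` with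
`μ(x+h) = μ x + μ h`, and `M = c·μ`.  Then
`‖e(−μ(h)x/N) − conj e(M(x+h)(x+h)/N) · e(M(h)h/N) · e(M(x)x/N)‖ ≤ 2π ‖toAddCircle(M(x)h − M(h)x)‖`.
[cite: GreenTao2008U3Inverse, §9 Step 3] -/
theorem norm_stdAddChar_neg_mu_sub_le {c : ZMod N} (hc : 2 * c = 1) (μ : ZMod N → ZMod N)
    {x h : ZMod N} (hadd : μ (x + h) = μ x + μ h) :
    ‖(ZMod.stdAddChar (-(μ h * x)) : ℂ) -
        conj (ZMod.stdAddChar (c * μ (x + h) * (x + h)) : ℂ) * ZMod.stdAddChar (c * μ h * h) *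
          ZMod.stdAddChar (c * μ x * x)‖ ≤
      2 * Real.pi * ‖ZMod.toAddCircle (c * μ x * h - c * μ h * x)‖ := by
  -- the Step-3 identity for `M = c·μ`, in `ℤ/Nℤ`
  have hM : (fun v => c * μ v) (x + h) = (fun v => c * μ v) x + (fun v => c * μ v) h := by
    simp only; rw [hadd, mul_add]
  have hid : -(μ h * x) = -(c * μ (x + h) * (x + h)) + c * μ h * h + c * μ x * x +
      (c * μ x * h - c * μ h * x) := by
    have h2 : μ h = 2 * (c * μ h) := by rw [← mul_assoc, hc, one_mul]
    rw [hadd]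
    have : -(μ h * x) = -(2 * (c * μ h) * x) := by rw [← h2]
    rw [this]; ring
  -- rewrite the product of characters as one character
  have hprod : conj (ZMod.stdAddChar (c * μ (x + h) * (x + h)) : ℂ) * ZMod.stdAddChar (c * μ h * h) *
      ZMod.stdAddChar (c * μ x * x) =
      ZMod.stdAddChar (-(c * μ (x + h) * (x + h)) + c * μ h * h + c * μ x * x) := by
    rw [conj_stdAddChar, ← AddChar.map_add_eq_mul, ← AddChar.map_add_eq_mul]
  rw [hprod, hid]
  refine (norm_stdAddChar_sub_stdAddChar_le _ _).trans (le_of_eq ?_)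
  congr 2
  ring

end Summit.Parity.GeneralizedHardyLittlewood.GreenTaoLevelTwoGITwoCyclicInverse
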